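import Summits.BirchSwinnertonDyer.BirchSwinnertonDyer.Theses.SemiOrdinaryEisensteinDescent
import Summits.BirchSwinnertonDyer.BirchSwinnertonDyer.Theorems.SemiOrdinaryEisensteinDescentWildKolyvaginUpperAtThreeOfMinftyGe
import HarnessLib

/-!
# Route `SemiOrdinaryEisensteinDescent`, crux Ko `WildKolyvaginUpperAtThree` (stmt-BirchSwinnertonDyer-20480), line
# `birth`: the McCALLUM ROAD — Ko BY NAME from the research stub (point currency J, or class currency
# `stub_minftyGeManin`) + Kolyvagin 1990 + McCallum 1991 Cor. 5.6 under the crux's OWN `3`-adic TOWER binder, with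
# NO appeal to the Matar–Nekovář §0.11 irreducible-image reading (width seat `bsd-wall-soed-p2-w2` g0;
# `--supports stmt-BirchSwinnertonDyer-20480`; BSD is not proved by any of this)

WHY. Every kernel road to Ko in the tree (utd-p3 g1 `WildKolyvaginUpperAtThreeOfGlobalDivisibility.wildKolyvaginUpperAtThree_of_globalDivisibility`,
p544141, closing the glue item 20762; lead g0 `WildKolyvaginUpperAtThreeOfMinftyGe.wildKolyvaginUpperAtThree_of_minftyGeManin`,
p567352, the composition of line `birth` v2) takes as its structure-theorem input the named fact
`MatarNekovar2019.thm07_padicValNat_card_sha_primary_add_le_of_globalDivisibility_of_irreducible` — Kolyvagin's structure theorem,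
upper half, under IRREDUCIBILITY of `ρ̄_{E,p}` only, which travels with the referee flags `MN19-0.11-structure-composite`
(the irreducible-image, reduction-free form is the authors' §0.11 introduction sentence assembling Kolyvagin [17, Thm. C/D]
with Lawson–Wuthrich, no line-by-line proof in print) and `Kolyvagin1991-ThmCD-primary-unread`; the crux text itself warns
«McCallum's structure theorem at p = 3 with 27 ∣ N is flagged unverified in the tree», and the width-3 method audit
(`Cruxes/WildKolyvaginUpperAtThree/NOGO-STRINGENT-SCALING-w3.md` §6 R4) names exactly this reading as the informative audit
target. But the crux CARRIES the binder `AdditiveThree.TowerSurjThree W` (`ρ_{E,3^n}` onto for every `n ≥ 1`), idle on both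
existing roads. Under the tower, Kolyvagin's structure theorem is McCallum's printed Cor. 5.6 with its printed image
hypothesis (mod `p`, strengthened to the tower as typed; McCallum §§4–5 carry no hypothesis on the reduction of `E` at `p`):
the named fact `McCallum1991_padicValNat_card_sha_primary_add_le_of_globalDivisibility` (`KolyvaginShaStructureDivisibility.lean`),
consumed by kmc g17's receptacle `SchneiderFree.Exact.upper_of_globalDivisibility` (`WildThreeRankOneBSDpOfGlobalDivisibility.lean`).
THIS FILE composes that receptacle with the crux's binders, so that Ko's closure from its research input no longer depends on
the §0.11 reading: if the Matar–Nekovář fact were ever re-typed with a reduction binder, item 20761's second conjunct could be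
replaced by McCallum's fact and the line / the glue would close by the theorems below, verbatim.

WHAT IS PROVED (all CONDITIONAL on the displayed named facts `hKo` = Kolyvagin 1990 Thm. A and `hMcU` = McCallum 1991
Cor. 5.6 upper form, taken as hypotheses, and on the research input; nothing is asserted about any curve):
* `upper_of_globalDivisibility_of_towerSurjThree` — kmc g17's McCallum-road receptacle
  `SchneiderFree.Exact.upper_of_globalDivisibility` re-keyed to the crux's binders (`TowerSurjThree`, `d_K` odd, `d_K ≠ −3`):
  global divisibility to depth `ord₃ ∏ c_ℓ + s` ⟹ the socket `Upper.IndexUpperBoundLeAt W 3 K P s` (the tower in McCallum's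
  spelling `∀ n, ρ̄_{E,3^n}` onto is kmc g20's three-line lemma, inlined).
* `wildKolyvaginUpperAtThree_of_globalDivisibility_of_mcCallum` — Ko BY NAME ⟸ `hKo` + `hMcU` + J₃ʷ displayed with EXACTLY
  Ko's binders (point currency `Koly.PDiv`, depth `ord₃ ∏ c_ℓ + v₃ c(Dt)`): the McCallum twin of p544141; the tower binder is
  USED, `d_K ≠ −4` from `d_K` odd.
* `wildKolyvaginUpperAtThree_of_sigma_of_mcCallum` — the same with the route's child J = `WildSigmaDivisibilityAtThree`
  (stmt-20760) BY NAME: `J → (∀ kolyvagin) → hMcU → Ko`, the McCallum twin of the glue `WildKolyvaginUpperAtThreeOfSigma`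
  (20762, closed via Matar–Nekovář).
* `wildKolyvaginUpperAtThree_of_minftyGeManin_of_mcCallum` — the same from line `birth`'s registered research stub
  `stub_minftyGeManin` VERBATIM (class currency `AdditiveThree.MinftyGe`), through lead g0's unconditional CLASS ⟹ POINT
  bridge `WildKolyvaginUpperAtThreeOfMinftyGe.globalDivisibility_of_minftyGe` (p567352): the McCallum twin of the line's
  composition `WildKolyvaginUpperAtThree_of`.
Ko, J, the refined Kolyvagin conjecture at `3` and BSD stay exactly as open as before; the research content (Σ-form beyond the
max-form) is untouched (see the w3 no-go memo for why no local-condition refinement can supply it).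

References: [McCallumLMS1991] §1 Theorem (Kolyvagin), §4 `S_r(M)` (pp. 299–300), §5 Lemma 5.1 (p. 303), Thm. 5.4,
Cor. 5.6 (p. 310); [GrossLMS1991] §1 Thm. 1.3, Prop. 6.2 (1) (p. 244: `v ∣ N` incl. `v ∣ p`); [Jetchev2008] §1 (1),
Conj. 1.3, Cor. 1.5 (p. 812); [MatarNekovar2019] Thm. 0.7 (p. 456), §0.11 (p. 457) — NOT used here; [WZhang2014] §3.8.
-/

set_option autoImplicit false
set_option linter.dupNamespace false -- `Summit.BirchSwinnertonDyer.BirchSwinnertonDyer.…` is the tree's layout (D-0017)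

noncomputable section

open scoped Classical

namespace Summit.BirchSwinnertonDyer.BirchSwinnertonDyer.Theorems.WildKolyvaginUpperAtThreeOfMcCallum

open WeierstrassCurve NumberField Field IsDedekindDomain Literature.NumberTheory.EllipticCurves
  Literature.NumberTheory.EllipticCurves.ModularForms
  Literature.NumberTheory.EllipticCurves.Rank1Residual
  Summit.BirchSwinnertonDyer.Rank1Residual
  Summit.BirchSwinnertonDyer.Rank1Residual.Additive
  Summit.BirchSwinnertonDyer.Rank1Residual.X11b
  Summit.BirchSwinnertonDyer.Rank1Residual.X11b.Three
  Summit.BirchSwinnertonDyer.BirchSwinnertonDyer.Theses.SemiOrdinaryEisensteinDescent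
  Summit.BirchSwinnertonDyer.BirchSwinnertonDyer.Theorems.SchneiderFree

/-! ## §0 The McCallum-road receptacle under the crux's tower binder (socket form) -/

/-- **co-STEP L at slack `s` from global divisibility to depth `ord₃ ∏ c_ℓ + s` + Kolyvagin 1990 + McCallum 1991 Cor. 5.6,
under `TowerSurjThree`.** kmc g17's receptacle `SchneiderFree.Exact.upper_of_globalDivisibility` wants `ρ̄_{E,3^n}` onto for
EVERY `n : ℕ`; the crux's binder `AdditiveThree.TowerSurjThree W` gives it for `n ≥ 1`, and at `n = 0` the torsion group
`E[3⁰]` is trivial, so every map onto its automorphism group is surjective (the three lines of kmc g20's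
`UniversalToricDescentWaldspurgerFlat.forall_hasSurjectiveModNGaloisRep_pow_three_of_towerSurjThree`, inlined to keep this
file inside the SOED cone). CONDITIONAL on the named facts `hKo`, `hMcU` and the displayed divisibility `hglob`.
[cite: McCallumLMS1991, §5 Cor. 5.6 (p. 310) and Lemma 5.1 (p. 303)] [cite: GrossLMS1991, §1 (B(E))] -/
theorem upper_of_globalDivisibility_of_towerSurjThree
    (hKo : ∀ (N : ℕ) [NeZero N] (W : WeierstrassCurve ℚ) (K : Type) [Field K] [NumberField K],
      kolyvagin N W K)
    (hMcU : McCallum1991_padicValNat_card_sha_primary_add_le_of_globalDivisibility)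
    (W : WeierstrassCurve ℚ) [W.IsElliptic] [W.IsGloballyMinimal] [NeZero (W.conductorNorm ℤ)]
    (htower : AdditiveThree.TowerSurjThree W)
    (K : Type) [Field K] [NumberField K] (hK : IsImaginaryQuadratic K)
    (hodd : Odd (NumberField.discr K)) (h3 : NumberField.discr K ≠ -3)
    (hHH : SatisfiesHeegnerHypothesis (W.conductorNorm ℤ) K)
    (Dt : ModularParametrizationData W (W.conductorNorm ℤ))
    (H : HeegnerDatum (W.conductorNorm ℤ) (NumberField.discr K)) (ι : K →+* ℂ)
    (P : (W.baseChange K).toAffine.Point)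
    (hP : WeierstrassCurve.Affine.Point.map ι.toRatAlgHom P = heegnerPointComplex Dt H)
    (hnt : ¬ IsOfFinAddOrder P) {s : ℕ}
    (hglob : ∀ (s' : ℕ), s' ≤ padicValNat 3 W.tamagawaProduct + s →
      ∀ (n : ℕ) (d : KolyvaginHeegnerData Dt H.β ι n), Squarefree n →
        (∀ ℓ ∈ n.primeFactors, Zhang2014.IsKolyvaginPrime (W.conductorNorm ℤ) W K 3 ℓ ∧
          s' ≤ Zhang2014.kolyvaginIndex W 3 ℓ) → Koly.PDiv d 3 s') :
    Upper.IndexUpperBoundLeAt W 3 K P s := by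
  haveI : Fact (Nat.Prime 3) := ⟨Nat.prime_three⟩
  have hD : NumberField.discr K < -4 :=
    WildKolyvaginUpperAtThreeOfMinftyGe.discr_lt_neg_four_of_odd hK hodd h3 H.dvd_sq_sub
  have h4 : NumberField.discr K ≠ -4 := by omega
  -- the tower in McCallum's spelling: `ρ̄_{E,3^n}` onto for every `n : ℕ` (level `3⁰` = trivial group)
  have hρ : ∀ n : ℕ, W.HasSurjectiveModNGaloisRep (3 ^ n : ℕ) := by
    intro n
    cases n with
    | zero =>
      haveI : Subsingleton (geomTorsion W ((3 ^ 0 : ℕ) : ℤ)) := ⟨fun a b ↦ by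
        have ha := AddSubgroup.torsionBy.nsmul_iff.mp a.2
        have hb := AddSubgroup.torsionBy.nsmul_iff.mp b.2
        simp only [pow_zero, one_smul] at ha hb
        exact Subtype.ext (ha.trans hb.symm)⟩
      intro y
      exact ⟨1, Multiplicative.toAdd.injective (AddEquiv.ext fun a ↦ Subsingleton.elim _ _)⟩
    | succ k => exact_mod_cast htower (k + 1) k.succ_pos
  exact Exact.upper_of_globalDivisibility hKo hMcU W 3 (by decide) hρ K hK h3 h4 hHH Dt H ι P hP hnt hglob

/-! ## §1 Ko BY NAME from J₃ʷ (point currency) + Kolyvagin + McCallum Cor. 5.6 under the tower -/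

/-- **Crux Ko `WildKolyvaginUpperAtThree` ⟸ J₃ʷ (displayed, point currency) + Kolyvagin 1990 (named) + McCallum 1991
Cor. 5.6 upper form (named), under the crux's own `3`-adic TOWER binder — no Matar–Nekovář §0.11 reading.** With EXACTLY
the crux's binders, `hJ` asserts global `3^{s′}`-divisibility of the derived Heegner points on the frame `(Dt, H.β, ι)` for every
`s′ ≤ ord₃ ∏_ℓ c_ℓ(E) + v₃(c(Dt))` (Jetchev 2008 Conj. 1.3, Σ-form, Manin-robust; NOT in print); kmc g17's receptacle
`SchneiderFree.Exact.upper_of_globalDivisibility` (McCallum road: `hKo`, `hMcU`, `ρ_{E,3^n}` onto for all `n` — supplied by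
`TowerSurjThree`, §0) turns it into the socket `Upper.IndexUpperBoundLeAt W 3 K P (v₃ c)`, the crux's conclusion;
`d_K ≠ −4` from `d_K` odd (`WildKolyvaginUpperAtThreeOfMinftyGe.discr_lt_neg_four_of_odd`, lead g0). The McCallum twin of
utd-p3 g1's `wildKolyvaginUpperAtThree_of_globalDivisibility` (p544141). CONDITIONAL on `hKo`, `hMcU`, `hJ`.
[cite: McCallumLMS1991, §5 Cor. 5.6 (p. 310) and Lemma 5.1 (p. 303)] [cite: Jetchev2008, Conj. 1.3 and (1) (p. 812)] -/
theorem wildKolyvaginUpperAtThree_of_globalDivisibility_of_mcCallum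
    (hKo : ∀ (N : ℕ) [NeZero N] (W : WeierstrassCurve ℚ) (K : Type) [Field K] [NumberField K],
      kolyvagin N W K)
    (hMcU : McCallum1991_padicValNat_card_sha_primary_add_le_of_globalDivisibility)
    (hJ : ∀ (W : WeierstrassCurve ℚ) [W.IsElliptic] [W.IsGloballyMinimal] (N : ℕ) [NeZero N] (K : Type)
      [Field K] [NumberField K] (Dt : ModularParametrizationData W N)
      (H : HeegnerDatum N (NumberField.discr K)) (ι : K →+* ℂ) (P : (W.baseChange K).toAffine.Point),
      ClassO6 W 3 → W.HasSurjectiveModNGaloisRep 3 → W.analyticRank = 1 → W.conductorNorm ℤ = N →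
      IsImaginaryQuadratic K → SatisfiesHeegnerHypothesis N K →
      (W.quadraticTwist (NumberField.discr K : ℚ)).entireLFunction 1 ≠ 0 →
      WeierstrassCurve.Affine.Point.map ι.toRatAlgHom P = heegnerPointComplex Dt H →
      ¬ IsOfFinAddOrder P → Odd (NumberField.discr K) → NumberField.discr K ≠ -3 →
      AdditiveThree.TowerSurjThree W →
      ∀ (s' : ℕ), s' ≤ padicValNat 3 W.tamagawaProduct + padicValNat 3 Dt.c.natAbs →
        ∀ (n : ℕ) (d : KolyvaginHeegnerData Dt H.β ι n), Squarefree n →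
          (∀ ℓ ∈ n.primeFactors, Zhang2014.IsKolyvaginPrime N W K 3 ℓ ∧
            s' ≤ Zhang2014.kolyvaginIndex W 3 ℓ) → Koly.PDiv d 3 s') :
    WildKolyvaginUpperAtThree := by
  intro W _ _ N _ K _ _ Dt H ι P hO6 hsurj hr hN hK hHH hLd hP hnt hodd h3 htower
  have hglob := hJ W N K Dt H ι P hO6 hsurj hr hN hK hHH hLd hP hnt hodd h3 htower
  subst hN
  exact upper_of_globalDivisibility_of_towerSurjThree hKo hMcU W htower K hK hodd h3 hHH Dt H ι P hP hnt hglob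

/-- **The McCallum twin of the glue `WildKolyvaginUpperAtThreeOfSigma` (stmt-20762): `J → (∀ kolyvagin) → McCallum Cor. 5.6
→ Ko`, all three route decls BY NAME** (J = `WildSigmaDivisibilityAtThree`, stmt-20760, the route's point-currency child of
Ko; its binders are Ko's verbatim, so the composition is binder bookkeeping over §1). CONDITIONAL on J (open research input),
`hKo`, `hMcU`. [cite: McCallumLMS1991, §5 Cor. 5.6 (p. 310)] [cite: Jetchev2008, Conj. 1.3 (p. 812)] -/
theorem wildKolyvaginUpperAtThree_of_sigma_of_mcCallum (hJ : WildSigmaDivisibilityAtThree)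
    (hKo : ∀ (N : ℕ) [NeZero N] (W : WeierstrassCurve ℚ) (K : Type) [Field K] [NumberField K],
      kolyvagin N W K)
    (hMcU : McCallum1991_padicValNat_card_sha_primary_add_le_of_globalDivisibility) :
    WildKolyvaginUpperAtThree :=
  wildKolyvaginUpperAtThree_of_globalDivisibility_of_mcCallum hKo hMcU
    fun W _ _ N _ K _ _ Dt H ι P hO6 hsurj hr hN hK hHH hLd hP hnt hodd h3 htower s' hs' n d hn hℓ ↦
      hJ W N K Dt H ι P hO6 hsurj hr hN hK hHH hLd hP hnt hodd h3 htower s' hs' n d hn hℓ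

/-! ## §2 Ko BY NAME from line `birth`'s class-currency stub + Kolyvagin + McCallum Cor. 5.6 under the tower -/

/-- **Crux Ko `WildKolyvaginUpperAtThree` ⟸ `stub_minftyGeManin` (line `birth`, registered, class currency, VERBATIM as a
hypothesis) + Kolyvagin 1990 (named) + McCallum 1991 Cor. 5.6 upper form (named), under the crux's own TOWER binder.**
Lead g0's unconditional CLASS ⟹ POINT bridge `WildKolyvaginUpperAtThreeOfMinftyGe.globalDivisibility_of_minftyGe` turns
`AdditiveThree.MinftyGe W K Dt H.β ι (ord₃ ∏ c_ℓ + v₃ c)` into global divisibility in point currency, and kmc g17's McCallum-road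
receptacle `SchneiderFree.Exact.upper_of_globalDivisibility` gives the socket; the tower binder is USED (§0), `ClassO6`,
`r_an = 1`, `L(E^{d_K},1) ≠ 0` are passed to `hM` and otherwise idle. The McCallum twin of the line's composition
`wildKolyvaginUpperAtThree_of_minftyGeManin` (p567352). CONDITIONAL on `hKo`, `hMcU`, `hM`; Ko, the conjecture and BSD stay
open. [cite: McCallumLMS1991, §5 Cor. 5.6 (p. 310) and §4 Cor. 4.5] [cite: WZhang2014, §3.8] [cite: Jetchev2008, Conj. 1.3 (p. 812)] -/
theorem wildKolyvaginUpperAtThree_of_minftyGeManin_of_mcCallum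
    (hKo : ∀ (N : ℕ) [NeZero N] (W : WeierstrassCurve ℚ) (K : Type) [Field K] [NumberField K],
      kolyvagin N W K)
    (hMcU : McCallum1991_padicValNat_card_sha_primary_add_le_of_globalDivisibility)
    (hM : ∀ (W : WeierstrassCurve ℚ) [W.IsElliptic] [W.IsGloballyMinimal],
      Summit.BirchSwinnertonDyer.Rank1Residual.Additive.ClassO6 W 3 → W.HasSurjectiveModNGaloisRep 3 →
      W.analyticRank = 1 → Summit.BirchSwinnertonDyer.Rank1Residual.AdditiveThree.TowerSurjThree W →
      ∀ (K : Type) [Field K] [NumberField K], Literature.NumberTheory.EllipticCurves.IsImaginaryQuadratic K →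
      Odd (NumberField.discr K) → NumberField.discr K ≠ -3 → ∀ [NeZero (W.conductorNorm ℤ)],
      Literature.NumberTheory.EllipticCurves.SatisfiesHeegnerHypothesis (W.conductorNorm ℤ) K →
      (W.quadraticTwist (NumberField.discr K : ℚ)).entireLFunction 1 ≠ 0 →
      ∀ (Dt : Literature.NumberTheory.EllipticCurves.ModularForms.ModularParametrizationData W (W.conductorNorm ℤ))
        (H : Literature.NumberTheory.EllipticCurves.HeegnerDatum (W.conductorNorm ℤ) (NumberField.discr K))
        (ι : K →+* ℂ) (P : (W.baseChange K).toAffine.Point),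
      (WeierstrassCurve.Affine.Point.map ι.toRatAlgHom) P =
        Literature.NumberTheory.EllipticCurves.ModularForms.heegnerPointComplex Dt H →
      ¬ IsOfFinAddOrder P →
      Summit.BirchSwinnertonDyer.Rank1Residual.AdditiveThree.MinftyGe W K Dt H.β ι
        (padicValNat 3 W.tamagawaProduct + padicValNat 3 Dt.c.natAbs)) :
    WildKolyvaginUpperAtThree := by
  intro W _ _ N _ K _ _ Dt H ι P hO6 hsurj hr hN hK hHH hLd hP hnt hodd h3 htower
  subst hN
  have hD : NumberField.discr K < -4 :=
    WildKolyvaginUpperAtThreeOfMinftyGe.discr_lt_neg_four_of_odd hK hodd h3 H.dvd_sq_sub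
  have ht := hM W hO6 hsurj hr htower K hK hodd h3 hHH hLd Dt H ι P hP hnt
  exact upper_of_globalDivisibility_of_towerSurjThree hKo hMcU W htower K hK hodd h3 hHH Dt H ι P hP hnt
    (WildKolyvaginUpperAtThreeOfMinftyGe.globalDivisibility_of_minftyGe W K hK hHH hD hsurj Dt H.β ι ht)

end Summit.BirchSwinnertonDyer.BirchSwinnertonDyer.Theorems.WildKolyvaginUpperAtThreeOfMcCallum

end
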